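import Literature.NumberTheory.LFunctions.CentralValueFamilyMollifiedMoments
import Literature.NumberTheory.LFunctions.IwaniecSarnakFamilyWeightTwoPeterssonPB
import HarnessLib

/-!
# From mollified moments (total-mass normalisation) to the prime-level edge and the summit leaf —
# re-threaded over the REPAIRED Petersson fact `kowalskiMichel2000_peterssonBound` (R2-G44 twins, `_pb`)

Topic `Literature/NumberTheory/LFunctions` (namespace
`Literature.NumberTheory.LFunctions.CentralValueFamilyHalfEdge`). PROOFS only — no definition, no
named fact (D-0026). Cell `landau-siegel`, F-S3, re-thread file **F8** of the R2-G44 repair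
(director-frontier split of record 2026-08-27T11:56:05Z).

`CentralValueFamilyMollifiedMoments.lean` proves `primeLevelFamilyTwo_EStarFam_of_mollifiedMoments_total`,
`lOneLowerBound_four_of_mollifiedMoments_prime_weightTwo` and `theorem1_of_mollifiedMoments_prime_weightTwo`
with the binder `(hP : KowalskiMichel2000.kowalskiMichel2000_petersson)` — the Kowalski–Michel Petersson
display typed for ALL `m, n ≥ 1`, which is FALSE AS TYPED
(`KowalskiMichel2000.not_kowalskiMichel2000_petersson`, witness `(q, q)`; refuted-as-typed ≠
refuted-in-print). This file lands their TWINS over the repaired fact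
`KowalskiMichel2000.kowalskiMichel2000_peterssonBound` (side condition `¬ (q ∣ m ∧ q ∣ n)`, Kowalski–Michel
p. 312 (23) "since `(m, q) = 1`"), through the F2 twins `abs_totalMass_sub_one_le_pb`,
`abs_two_mul_evenMass_sub_totalMass_le_pb`, `lOne_lowerBound_of_EStarFam_prime_weightTwo'_pb` of
`IwaniecSarnakFamilyWeightTwoPeterssonPB.lean`. Proofs verbatim otherwise; landed declarations are
untouched; nothing here uses the negative lemma (no ex falso).

WHAT THIS IS NOT: no claim that the moment hypotheses hold for any mollifier; nothing about
Landau–Siegel zeros. «The programme SEARCHES and TYPES; no claim about Landau–Siegel zeros, Theorems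
1–2 of arXiv:2211.02515 or a repaired Margin232 until a kernel theorem says so.»

## References

* [KowalskiMichelVanderKam2000] E. Kowalski, P. Michel, J. VanderKam, J. reine angew. Math. 526
  (2000), §1 (2), Thm. 1.1.
* [BalkanovaFrolenkov2021] §8.4, proof of Theorem 8.7.
* [KowalskiMichel2000] Acta Arith. 94 (2000), §2.3 p. 310 (display after (16)), §2.4.2 p. 312 (23) —
  repaired fact `KowalskiMichel2000.kowalskiMichel2000_peterssonBound`.
* [IwaniecConversations2006] §7 (7.7), p. 97.
* [Zhang2022LandauSiegel] §1 Theorem 1 (shape `LOneLowerBound`).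
-/

noncomputable section

namespace Literature.NumberTheory.LFunctions.CentralValueFamilyHalfEdge

open scoped MatrixGroups
open Finset CongruenceSubgroup
open Literature.NumberTheory.EllipticCurves.ModularForms
open Literature.NumberTheory.LFunctions.IwaniecSarnak
open Literature.NumberTheory.LFunctions.CentralValueFamilyPigeonhole

section IwaniecSarnakVocabulary

/-- **MOLLIFIED HARMONIC MOMENTS AT PRIME LEVEL, WEIGHT 2, TOTAL-MASS NORMALISATION ⇒ THE PRIME-LEVEL
EDGE SOCKET.** Assume the non-negativity fact, the REPAIRED Kowalski–Michel Petersson fact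
`kowalskiMichel2000_peterssonBound` (R2-G44 twin of `primeLevelFamilyTwo_EStarFam_of_mollifiedMoments_total`), and that for every
`ε > 0`, for all large primes `q`, there are real mollifier values `M` on `S₂(Γ₀(q))` with
`A₁ = Σʰ ω M L(½,f) > 0`, Cauchy–Schwarz value against the TOTAL harmonic mass `T = Σʰ ω` at least
`v − ε` (`(v − ε)·T·Σʰ ω M² L(½,f)² ≤ A₁²`) and `(log q)⁻⁴·T·Σʰ ω M² ≤ ε²·A₁²`. If `v > ¼` then
`∃ p₁ > ½, primeLevelFamilyTwo.EStarFam p₁ 2`. The even harmonic mass is `≤ (½ + o(1))·T` by the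
repaired Petersson fact at `(m,n) = (q,1), (1,1)` (`abs_two_mul_evenMass_sub_totalMass_le_pb`,
`abs_totalMass_sub_one_le_pb`; side conditions `¬(q ∣ q ∧ q ∣ 1)`, `¬(q ∣ 1 ∧ q ∣ 1)`), which converts «`> ¼` of all» into «`> ½` of the even» (`r = v + ¼`).
Nothing here asserts the hypotheses for any `M`.
[cite: KowalskiMichelVanderKam2000, §1 (2) and Thm. 1.1 («p₀ ≥ ¼» of all forms)] [cite: BalkanovaFrolenkov2021, §8.4 proof of Theorem 8.7] -/
theorem primeLevelFamilyTwo_EStarFam_of_mollifiedMoments_total_pb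
    (hLR : lapidRallis2003_theorem1_gl2Twist) (hP : KowalskiMichel2000.kowalskiMichel2000_peterssonBound)
    {v : ℝ} (hv : 1 / 4 < v)
    (H : ∀ ε : ℝ, 0 < ε → ∃ N₀ : ℕ, ∀ (N : ℕ) [NeZero N], N₀ ≤ N → N.Prime →
      ∃ M : CuspForm (Gamma0 N) 2 → ℝ,
        0 < harmonicSum N 2 (fun f => M f * (centralValue f).re) ∧
        (v - ε) * harmonicSum N 2 (fun _ => (1 : ℝ)) *
            harmonicSum N 2 (fun f => M f ^ 2 * (centralValue f).re ^ 2) ≤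
          harmonicSum N 2 (fun f => M f * (centralValue f).re) ^ 2 ∧
        (Real.log N)⁻¹ ^ 4 * harmonicSum N 2 (fun _ => (1 : ℝ)) *
            harmonicSum N 2 (fun f => M f ^ 2) ≤
          ε ^ 2 * harmonicSum N 2 (fun f => M f * (centralValue f).re) ^ 2) :
    ∃ p₁ : ℝ, 1 / 2 < p₁ ∧ primeLevelFamilyTwo.EStarFam p₁ 2 := by
  obtain ⟨C₁, hT⟩ := abs_totalMass_sub_one_le_pb hP
  obtain ⟨C₂, hE⟩ := abs_two_mul_evenMass_sub_totalMass_le_pb hP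
  have hk : (2 : ℤ) ≤ 2 := le_rfl
  -- the even-mass ratio `r = v + ¼ > ½` (strictly between `½` and `2v`)
  set r : ℝ := v + 1 / 4 with hrdef
  have hr : 1 / 2 < r := by rw [hrdef]; linarith
  have hrpos : 0 < r := by linarith
  refine primeLevelFamilyTwo_EStarFam_of_mollifiedMoments hLR hr (fun ε hε => ?_)
  -- slacks: `ε' = (4v − 1)/16` on the KMV side, `δ' = ε'/r` on the even share
  set ε' : ℝ := (4 * v - 1) / 16 with hε'def
  have hε' : 0 < ε' := by rw [hε'def]; linarith
  set δ' : ℝ := ε' / r with hδ'def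
  have hδ' : 0 < δ' := div_pos hε' hrpos
  have hrδ' : r * δ' = ε' := by rw [hδ'def]; field_simp
  obtain ⟨N₀, hN₀⟩ := H (min ε' ε) (lt_min hε' hε)
  set Mc : ℝ := max C₂ 0 with hMcdef
  have hMc : 0 ≤ Mc := le_max_right _ _
  refine ⟨max N₀ (max ⌈8 * C₁⌉₊ ⌈(Mc / δ') ^ 4⌉₊), fun N _ hN hprime _ => ?_⟩
  have hN₀le : N₀ ≤ N := le_trans (le_max_left _ _) hN
  have h8 : 8 * C₁ ≤ (N : ℝ) :=
    le_trans (Nat.le_ceil _) (by exact_mod_cast le_trans (le_trans (le_max_left _ _) (le_max_right _ _)) hN)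
  have h4 : (Mc / δ') ^ 4 ≤ (N : ℝ) :=
    le_trans (Nat.le_ceil _) (by exact_mod_cast le_trans (le_trans (le_max_right _ _) (le_max_right _ _)) hN)
  have hq1 : (1 : ℝ) ≤ N := by exact_mod_cast hprime.one_lt.le
  have hqpos : (0 : ℝ) < N := lt_of_lt_of_le one_pos hq1
  obtain ⟨M, h1, h2, h3⟩ := hN₀ N hN₀le hprime
  -- abbreviations
  set T : ℝ := harmonicSum N 2 (fun _ => (1 : ℝ)) with hTdef
  set E : ℝ := harmonicSum N 2 (fun f => if rootNumber f = 1 then (1 : ℝ) else 0) with hEdef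
  set A₁ : ℝ := harmonicSum N 2 (fun f => M f * (centralValue f).re) with hA₁def
  set A₂ : ℝ := harmonicSum N 2 (fun f => M f ^ 2 * (centralValue f).re ^ 2) with hA₂def
  set Nn : ℝ := harmonicSum N 2 (fun f => M f ^ 2) with hNndef
  have hEnn : 0 ≤ E := harmonicSum_nonneg hk fun f => by positivity
  have hA₂nn : 0 ≤ A₂ := harmonicSum_nonneg hk fun f => by positivity
  have hNn : 0 ≤ Nn := harmonicSum_nonneg hk fun f => by positivity
  have hET : E ≤ T :=
    harmonicSum_mono hk (finite_newforms0_holds N 2) fun f _ => by split_ifs <;> norm_num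
  -- the total-mass error is `≤ 1/8`, so `T ≥ 7/8`
  have ha : C₁ * (N : ℝ) ^ (-(3 / 2 : ℝ)) ≤ 1 / 8 := by
    have hrpow : (N : ℝ) ^ (-(3 / 2 : ℝ)) ≤ (N : ℝ)⁻¹ := by
      rw [← Real.rpow_neg_one]
      exact Real.rpow_le_rpow_of_exponent_le hq1 (by norm_num)
    have hrp : 0 ≤ (N : ℝ) ^ (-(3 / 2 : ℝ)) := Real.rpow_nonneg hqpos.le _
    rcases le_or_gt 0 C₁ with hc | hc
    · calc C₁ * (N : ℝ) ^ (-(3 / 2 : ℝ)) ≤ C₁ * (N : ℝ)⁻¹ := mul_le_mul_of_nonneg_left hrpow hc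
        _ ≤ 1 / 8 := by rw [← div_eq_mul_inv, div_le_iff₀ hqpos]; linarith
    · linarith [mul_nonpos_of_nonpos_of_nonneg hc.le hrp]
  have hT' := abs_le.mp (le_trans (hT N hprime) ha)
  have hT78 : 7 / 8 ≤ T := by rw [hTdef]; linarith [hT'.1]
  -- the root-number-sum error is `≤ δ'`, so `E ≤ (½ + δ')·T`
  have hb : C₂ * (N : ℝ) ^ (-(1 / 4 : ℝ)) ≤ δ' := by
    have hrp : 0 ≤ (N : ℝ) ^ (-(1 / 4 : ℝ)) := Real.rpow_nonneg hqpos.le _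
    have h4' : (0 : ℝ) ≤ (Mc / δ') ^ 4 := by positivity
    have hmono := Real.rpow_le_rpow h4' h4 (by norm_num : (0 : ℝ) ≤ 1 / 4)
    have e : ((Mc / δ') ^ 4) ^ (1 / 4 : ℝ) = Mc / δ' := by
      rw [show (1 / 4 : ℝ) = ((4 : ℕ) : ℝ)⁻¹ by norm_num]
      exact Real.pow_rpow_inv_natCast (by positivity) (by norm_num)
    rw [e] at hmono
    have hqr : 0 < (N : ℝ) ^ (1 / 4 : ℝ) := Real.rpow_pos_of_pos hqpos _
    calc C₂ * (N : ℝ) ^ (-(1 / 4 : ℝ)) ≤ Mc * (N : ℝ) ^ (-(1 / 4 : ℝ)) :=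
          mul_le_mul_of_nonneg_right (le_max_left _ _) hrp
      _ = Mc * ((N : ℝ) ^ (1 / 4 : ℝ))⁻¹ := by rw [Real.rpow_neg hqpos.le]
      _ ≤ δ' := by
          rw [mul_inv_le_iff₀ hqr]
          calc Mc = Mc / δ' * δ' := by field_simp
            _ ≤ (N : ℝ) ^ (1 / 4 : ℝ) * δ' := mul_le_mul_of_nonneg_right hmono hδ'.le
            _ = δ' * (N : ℝ) ^ (1 / 4 : ℝ) := mul_comm _ _
  have hE' := abs_le.mp (le_trans (hE N hprime) hb)
  have hEle : E ≤ (1 / 2 + δ') * T := by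
    have : 2 * E ≤ T + δ' := by rw [hEdef, hTdef]; linarith [hE'.2]
    nlinarith
  refine ⟨M, h1, ?_, ?_⟩
  · -- the Cauchy–Schwarz value against the EVEN mass
    have hTA : 0 ≤ T * A₂ := mul_nonneg (by linarith) hA₂nn
    have hmin : (v - ε') * T * A₂ ≤ A₁ ^ 2 := by
      refine le_trans ?_ h2
      have : (v - ε') * T * A₂ ≤ (v - min ε' ε) * T * A₂ := by
        rw [mul_assoc, mul_assoc]
        exact mul_le_mul_of_nonneg_right (by linarith [min_le_left ε' ε]) hTA
      exact this
    rcases le_or_gt (r - ε) 0 with hneg | hposre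
    · calc (r - ε) * E * A₂ = (r - ε) * (E * A₂) := by ring
        _ ≤ 0 := mul_nonpos_of_nonpos_of_nonneg hneg (mul_nonneg hEnn hA₂nn)
        _ ≤ A₁ ^ 2 := sq_nonneg _
    · calc (r - ε) * E * A₂ ≤ (r - ε) * ((1 / 2 + δ') * T) * A₂ :=
            mul_le_mul_of_nonneg_right (mul_le_mul_of_nonneg_left hEle hposre.le) hA₂nn
        _ = (r - ε) * ((1 / 2 + δ') * (T * A₂)) := by ring
        _ ≤ r * ((1 / 2 + δ') * (T * A₂)) :=
            mul_le_mul_of_nonneg_right (by linarith) (mul_nonneg (by linarith) hTA)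
        _ = (r / 2 + r * δ') * T * A₂ := by ring
        _ = (v - ε') * T * A₂ := by rw [hrδ', hrdef, hε'def]; ring
        _ ≤ A₁ ^ 2 := hmin
  · -- the floor against the EVEN mass
    have hlog : 0 ≤ (Real.log N)⁻¹ ^ 4 := pow_nonneg (inv_nonneg.mpr (Real.log_natCast_nonneg _)) _
    calc (Real.log N)⁻¹ ^ 4 * E * Nn ≤ (Real.log N)⁻¹ ^ 4 * T * Nn :=
          mul_le_mul_of_nonneg_right (mul_le_mul_of_nonneg_left hET hlog) hNn
      _ ≤ (min ε' ε) ^ 2 * A₁ ^ 2 := h3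
      _ ≤ ε ^ 2 * A₁ ^ 2 :=
          mul_le_mul_of_nonneg_right
            (pow_le_pow_left₀ (le_min hε'.le hε.le) (min_le_right _ _) 2) (sq_nonneg _)

/-! ### The summit vocabulary -/

/-- **Mollified harmonic moments beyond a quarter + the four printed facts ⇒ `LOneLowerBound 4`**
(`L(1,χ) > c₁(log D)⁻⁴` for every real primitive `χ` mod `D ≥ 3`): the total-mass moment hypotheses
at prime level, weight `2`, with `v > ¼`, give the prime-level edge
(`primeLevelFamilyTwo_EStarFam_of_mollifiedMoments_total_pb`); the weight-2 decision display with four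
printed facts over the REPAIRED Petersson fact (`lOne_lowerBound_of_EStarFam_prime_weightTwo'_pb`) and the eventual→skeleton bridge
(`lOneLowerBound_of_eventual`) conclude. Every fact is a displayed hypothesis; none is asserted.
[cite: IwaniecConversations2006, §7 (7.7) and p. 97] [cite: Zhang2022LandauSiegel, §1 Theorem 1 (shape `LOneLowerBound`)] -/
theorem lOneLowerBound_four_of_mollifiedMoments_prime_weightTwo_pb
    (hLR : lapidRallis2003_theorem1_gl2Twist) (hTw : iwaniec2006_twistedHalf)
    (hMix : iwaniec2006_mixedMomentOverMass) (hP : KowalskiMichel2000.kowalskiMichel2000_peterssonBound)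
    {v : ℝ} (hv : 1 / 4 < v)
    (H : ∀ ε : ℝ, 0 < ε → ∃ N₀ : ℕ, ∀ (N : ℕ) [NeZero N], N₀ ≤ N → N.Prime →
      ∃ M : CuspForm (Gamma0 N) 2 → ℝ,
        0 < harmonicSum N 2 (fun f => M f * (centralValue f).re) ∧
        (v - ε) * harmonicSum N 2 (fun _ => (1 : ℝ)) *
            harmonicSum N 2 (fun f => M f ^ 2 * (centralValue f).re ^ 2) ≤
          harmonicSum N 2 (fun f => M f * (centralValue f).re) ^ 2 ∧
        (Real.log N)⁻¹ ^ 4 * harmonicSum N 2 (fun _ => (1 : ℝ)) *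
            harmonicSum N 2 (fun f => M f ^ 2) ≤
          ε ^ 2 * harmonicSum N 2 (fun f => M f * (centralValue f).re) ^ 2) :
    Zhang2022.Skeleton.LOneLowerBound 4 := by
  obtain ⟨p₁, hp₁, hEdge⟩ := primeLevelFamilyTwo_EStarFam_of_mollifiedMoments_total_pb hLR hP hv H
  refine lOneLowerBound_of_eventual ?_
  obtain ⟨c, hc, D₀, h⟩ := lOne_lowerBound_of_EStarFam_prime_weightTwo'_pb hLR hTw hMix hP hp₁ hEdge
  exact ⟨c, hc, D₀, fun D _ χ hD hprim hquad => h D χ hD hprim hquad⟩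

/-- **… and hence `Zhang2022.Skeleton.Theorem1`** (`= LOneLowerBound 2022`, by
`Section1.lOneLowerBound_mono`, `4 ≤ 2022`): the mollified-moment hypotheses beyond a quarter at prime
level, weight `2`, plus the four printed facts (Petersson in its REPAIRED form), conclude the Landau–Siegel
rung's leaf of record (R2-G44 twin). A
CONDITIONAL display: the moment hypotheses are OPEN IN PRINT beyond the diagonal (KMV2000 prove them for
`Δ < 1`, where `v < ¼`). [cite: Zhang2022LandauSiegel, §1 Theorem 1] [cite: IwaniecConversations2006, §7 (7.7)] -/
theorem theorem1_of_mollifiedMoments_prime_weightTwo_pb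
    (hLR : lapidRallis2003_theorem1_gl2Twist) (hTw : iwaniec2006_twistedHalf)
    (hMix : iwaniec2006_mixedMomentOverMass) (hP : KowalskiMichel2000.kowalskiMichel2000_peterssonBound)
    {v : ℝ} (hv : 1 / 4 < v)
    (H : ∀ ε : ℝ, 0 < ε → ∃ N₀ : ℕ, ∀ (N : ℕ) [NeZero N], N₀ ≤ N → N.Prime →
      ∃ M : CuspForm (Gamma0 N) 2 → ℝ,
        0 < harmonicSum N 2 (fun f => M f * (centralValue f).re) ∧
        (v - ε) * harmonicSum N 2 (fun _ => (1 : ℝ)) *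
            harmonicSum N 2 (fun f => M f ^ 2 * (centralValue f).re ^ 2) ≤
          harmonicSum N 2 (fun f => M f * (centralValue f).re) ^ 2 ∧
        (Real.log N)⁻¹ ^ 4 * harmonicSum N 2 (fun _ => (1 : ℝ)) *
            harmonicSum N 2 (fun f => M f ^ 2) ≤
          ε ^ 2 * harmonicSum N 2 (fun f => M f * (centralValue f).re) ^ 2) :
    Zhang2022.Skeleton.Theorem1 :=
  Zhang2022.Section1.lOneLowerBound_mono (by norm_num)
    (lOneLowerBound_four_of_mollifiedMoments_prime_weightTwo_pb hLR hTw hMix hP hv H)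

end IwaniecSarnakVocabulary

end Literature.NumberTheory.LFunctions.CentralValueFamilyHalfEdge

end
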